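import Summits.ABC.IUTFork.Cor312ColumnTransport
import Summits.ABC.IUTFork.Cor312QTwist
import Summits.ABC.IUTFork.Cor312LogKummerRoute2
import HarnessLib

/-!
# The lattice-level residual B-INPUT under the C-transports (row C-14b)

Companion of `Cor312VolumeTransportTwist` (row C-14a) at the HOLOMORPHIC-reading level: the residual
B-INPUT decls of GAP row G-c312-11-1 — `Cor312Vol.QFrobComparison` / `QFrobEqualityAt` (p411648; the
printed (xi-g) sentence p. 184 l. 30–34 with both sides read through `Column.frobLogvol`) — under the
four transports of the C census.  Three findings, each kernel-checked:

* **Θ-glue / q-glue twists** (rows C-1/C-7): the readings `frobLogvol m` are a COLUMN structure, not a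
  volume datum of the frozen `Cor312.Setting`, so their invariance under the indeterminacy families is an
  EXPLICIT hypothesis (`hfrobθ` / `hfrobq`) — stated as the honest cost it is — and is DISCHARGED on
  admissible regions by typed Thm. 3.11 (ii) (a) (`Column.KummerA`: the readings agree with the
  mono-analytic log-volumes there) + the Step (x) closure engine
  (`frobLogvol_image_eq_of_kummerA_of_invariance`).
* **(Ind3) m-reindex** (rows C-1/C-9): the lattice-level B-INPUT is **m-COUPLED** — the reading label
  `frobLogvol m` rides with the region label `thetaRegion m`, and the (Ind3) relabelling moves only the
  latter (`reindexGlue_qFrobComparison_decoupled`, an `Iff.rfl`).  Invariance is restored exactly under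
  m-INDEPENDENT readings (`hfc`; the shape `logvol_thetaRegion_eq_of_latticeRealisations` of p413177
  proves at lattice realisations).  This is row C-13's «the per-`m` pin tracks the (Ind3) m-relabelling»
  finding at the B-INPUT level.
* **étale-picture column transport** (row C-3): the transported comparison is equivalent to the original
  modulo ONE explicit cross-column transport of the readings (`hfrobMap`) — the frozen vocabulary
  supplies no such clause (the C-13c pattern: étale symmetry does not identify the columns' Kummer
  readings) — and `hfrobMap` is a THEOREM on admissible regions when `Column.KummerA` holds at BOTH
  columns (`recolumn_frobLogvol_map_of_kummerA`): Thm. 3.11 (ii)-ACROSS-COLUMNS content, exactly as the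
  C-2 ledger charter predicts.

Subjects consumed read-only by name from p411648 (`Cor312LogKummerRoute2`); transports from rows C-1/C-3/
C-7; engine from L6-t13 (`Thm311MultiradProofs`).  Nothing here asserts Cor. 3.12 or that any reading
hypothesis HOLDS; `[claim: Mochizuki2012, status: disputed]` on statements quoting the print, bookkeeping
proofs `[folklore]`.
-/

noncomputable section

namespace Summit.ABC

namespace IUTFork

namespace Cor312Vol

open Thm311 Cor312 Literature.IUT.LogThetaLattice

variable {T : ThetaIndex} {S' : LatticeSituation T}

/-! ## 0. Congruence: the lattice-level B-INPUT reads only the per-packet `frobLogvol` values -/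

/-- **Congruence for the printed (uniform, equality) form**: two settings whose q-side and Θ-side
holomorphic readings agree packet-by-packet have the same `QFrobEqualityAt`. [folklore] -/
theorem qFrobEqualityAt_congr {P₁ P₂ : Cor312.Setting S'.toSituation}
    (hqf : ∀ (m : ℤ) (i : Fin T.lstar) (vQ : T.VQ),
      (S'.col P₁.n).frobLogvol m (Setting.labelSucc i) vQ (P₁.qRegion (Setting.labelSucc i) vQ) =
        (S'.col P₂.n).frobLogvol m (Setting.labelSucc i) vQ (P₂.qRegion (Setting.labelSucc i) vQ))
    (hθf : ∀ (m : ℤ) (i : Fin T.lstar) (vQ : T.VQ),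
      (S'.col P₁.n).frobLogvol m (Setting.labelSucc i) vQ
          (P₁.thetaRegion m (Setting.labelSucc i) vQ) =
        (S'.col P₂.n).frobLogvol m (Setting.labelSucc i) vQ
          (P₂.thetaRegion m (Setting.labelSucc i) vQ))
    (m : ℤ) : QFrobEqualityAt P₁ m ↔ QFrobEqualityAt P₂ m := by
  unfold QFrobEqualityAt
  constructor <;> intro h i vQ
  · rw [← hqf m i vQ, ← hθf m i vQ]
    exact h i vQ
  · rw [hqf m i vQ, hθf m i vQ]
    exact h i vQ

/-- **Congruence for the pointwise `≤`-form** (same hypotheses, `∃ m`). [folklore] -/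
theorem qFrobComparison_congr {P₁ P₂ : Cor312.Setting S'.toSituation}
    (hqf : ∀ (m : ℤ) (i : Fin T.lstar) (vQ : T.VQ),
      (S'.col P₁.n).frobLogvol m (Setting.labelSucc i) vQ (P₁.qRegion (Setting.labelSucc i) vQ) =
        (S'.col P₂.n).frobLogvol m (Setting.labelSucc i) vQ (P₂.qRegion (Setting.labelSucc i) vQ))
    (hθf : ∀ (m : ℤ) (i : Fin T.lstar) (vQ : T.VQ),
      (S'.col P₁.n).frobLogvol m (Setting.labelSucc i) vQ
          (P₁.thetaRegion m (Setting.labelSucc i) vQ) =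
        (S'.col P₂.n).frobLogvol m (Setting.labelSucc i) vQ
          (P₂.thetaRegion m (Setting.labelSucc i) vQ)) :
    QFrobComparison P₁ ↔ QFrobComparison P₂ := by
  unfold QFrobComparison
  constructor <;> intro h i vQ
  · obtain ⟨m, hm⟩ := h i vQ
    rw [hqf m i vQ, hθf m i vQ] at hm
    exact ⟨m, hm⟩
  · obtain ⟨m, hm⟩ := h i vQ
    rw [← hqf m i vQ, ← hθf m i vQ] at hm
    exact ⟨m, hm⟩

/-! ## 1. The Θ-glue (Ind1)(Ind2) twist: explicit reading cost, discharged via KummerA + Step (x) -/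

section TwistGlue

variable (P : Cor312.Setting S'.toSituation) (Φ₀ : S'.toSituation.L.PacketAut)

/-- `QFrobEqualityAt` under the Θ-glue twist, modulo the EXPLICIT hypothesis that the holomorphic
readings do not see the twist of the Θ-images (no frozen clause supplies it). [claim: Mochizuki2012,
status: disputed] -/
theorem twistGlue_qFrobEqualityAt_iff
    (hfrobθ : ∀ (m : ℤ) (i : Fin T.lstar) (vQ : T.VQ),
      (S'.col P.n).frobLogvol m (Setting.labelSucc i) vQ
          (Φ₀ (Setting.labelSucc i) vQ '' P.thetaRegion m (Setting.labelSucc i) vQ) =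
        (S'.col P.n).frobLogvol m (Setting.labelSucc i) vQ
          (P.thetaRegion m (Setting.labelSucc i) vQ))
    (m : ℤ) : QFrobEqualityAt (P.twistGlue Φ₀) m ↔ QFrobEqualityAt P m :=
  qFrobEqualityAt_congr (P₁ := P.twistGlue Φ₀) (P₂ := P)
    (fun _ _ _ => rfl) (fun mm i vQ => hfrobθ mm i vQ) m

/-- `QFrobComparison` under the Θ-glue twist, same explicit cost. [claim: Mochizuki2012, status:
disputed] -/
theorem twistGlue_qFrobComparison_iff
    (hfrobθ : ∀ (m : ℤ) (i : Fin T.lstar) (vQ : T.VQ),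
      (S'.col P.n).frobLogvol m (Setting.labelSucc i) vQ
          (Φ₀ (Setting.labelSucc i) vQ '' P.thetaRegion m (Setting.labelSucc i) vQ) =
        (S'.col P.n).frobLogvol m (Setting.labelSucc i) vQ
          (P.thetaRegion m (Setting.labelSucc i) vQ)) :
    QFrobComparison (P.twistGlue Φ₀) ↔ QFrobComparison P :=
  qFrobComparison_congr (P₁ := P.twistGlue Φ₀) (P₂ := P)
    (fun _ _ _ => rfl) (fun mm i vQ => hfrobθ mm i vQ)

/-- **Discharge of the reading cost on admissible regions**: typed Thm. 3.11 (ii) (a)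
(`Column.KummerA` — the holomorphic readings agree with the mono-analytic log-volumes on admissible
regions) + generator admissibility transport + `MRData.LogvolInvariant` (Step (x)) make the readings
blind to any `Φ₀ ∈ indGroup` on admissible regions. [folklore] -/
theorem frobLogvol_image_eq_of_kummerA_of_invariance
    (hka : (S'.col P.n).KummerA (S'.D P.n))
    (hAdm : ∀ Φ ∈ S'.toSituation.L.Ind1Family ∪ S'.toSituation.L.Ind2Family,
      ∀ (j : T.Label) (vQ : T.VQ) (A : Set (S'.toSituation.L.Packet j vQ)),
        (S'.D P.n).Adm j vQ A ↔ (S'.D P.n).Adm j vQ (Φ j vQ '' A))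
    (hvol : (S'.D P.n).LogvolInvariant) (hΦ₀ : Φ₀ ∈ Setting.indGroup S'.toSituation)
    (m : ℤ) (j : T.Label) (vQ : T.VQ) {A : Set (S'.toSituation.L.Packet j vQ)}
    (hA : (S'.D P.n).Adm j vQ A) :
    (S'.col P.n).frobLogvol m j vQ (Φ₀ j vQ '' A) = (S'.col P.n).frobLogvol m j vQ A := by
  have hpair := (S'.D P.n).adm_iff_and_logvol_eq_of_mem_closure hAdm hvol hΦ₀ j vQ A
  have hA' : (S'.D P.n).Adm j vQ (Φ₀ j vQ '' A) := hpair.1.mp hA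
  rw [(hka m j vQ _ hA').2, (hka m j vQ A hA).2, hpair.2 hA]

/-- Θ-glue canonicity of the residual B-INPUT under typed (ii) (a) + the Step (x) engine +
`ThetaRegionsAdm`. [claim: Mochizuki2012, status: disputed] -/
theorem twistGlue_qFrobComparison_iff_of_invariance
    (hka : (S'.col P.n).KummerA (S'.D P.n))
    (hAdm : ∀ Φ ∈ S'.toSituation.L.Ind1Family ∪ S'.toSituation.L.Ind2Family,
      ∀ (j : T.Label) (vQ : T.VQ) (A : Set (S'.toSituation.L.Packet j vQ)),
        (S'.D P.n).Adm j vQ A ↔ (S'.D P.n).Adm j vQ (Φ j vQ '' A))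
    (hvol : (S'.D P.n).LogvolInvariant) (hΦ₀ : Φ₀ ∈ Setting.indGroup S'.toSituation)
    (hadm : ThetaRegionsAdm P) :
    QFrobComparison (P.twistGlue Φ₀) ↔ QFrobComparison P :=
  twistGlue_qFrobComparison_iff P Φ₀ (fun mm i vQ =>
    frobLogvol_image_eq_of_kummerA_of_invariance P Φ₀ hka hAdm hvol hΦ₀ mm
      (Setting.labelSucc i) vQ (hadm mm i vQ))

end TwistGlue

/-! ## 2. The (Ind3) m-reindex: the lattice-level B-INPUT is m-COUPLED -/

section ReindexGlue

variable (P : Cor312.Setting S'.toSituation) (e : ℤ ≃ ℤ)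

/-- **THE m-COUPLING, kernel-visible at zero cost**: the reading label of `frobLogvol` rides with the
region label, and the (Ind3) relabelling moves only the latter — the reindexed comparison is the
DECOUPLED statement (reading at `m`, region at `e m`), definitionally. [folklore] -/
theorem reindexGlue_qFrobComparison_decoupled :
    QFrobComparison (P.reindexGlue e) ↔ ∀ (i : Fin T.lstar) (vQ : T.VQ), ∃ m : ℤ,
      (S'.col P.n).frobLogvol m (Setting.labelSucc i) vQ (P.qRegion (Setting.labelSucc i) vQ) ≤
        (S'.col P.n).frobLogvol m (Setting.labelSucc i) vQ
          (P.thetaRegion (e m) (Setting.labelSucc i) vQ) :=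
  Iff.rfl

/-- Under m-INDEPENDENT readings (the `logvol_thetaRegion_eq_of_latticeRealisations` shape of p413177)
the printed equality form is COVARIANT under the (Ind3) relabelling, `m ↦ e m`. [claim: Mochizuki2012,
status: disputed] -/
theorem reindexGlue_qFrobEqualityAt_iff_of_frobConst
    (hfc : ∀ (m m' : ℤ) (j : T.Label) (vQ : T.VQ) (A : Set (S'.toSituation.L.Packet j vQ)),
      (S'.col P.n).frobLogvol m j vQ A = (S'.col P.n).frobLogvol m' j vQ A)
    (m : ℤ) : QFrobEqualityAt (P.reindexGlue e) m ↔ QFrobEqualityAt P (e m) := by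
  unfold QFrobEqualityAt
  constructor <;> intro h i vQ
  · have hh := h i vQ
    calc (S'.col P.n).frobLogvol (e m) (Setting.labelSucc i) vQ
          (P.qRegion (Setting.labelSucc i) vQ)
        = (S'.col P.n).frobLogvol m (Setting.labelSucc i) vQ
            (P.qRegion (Setting.labelSucc i) vQ) := hfc (e m) m _ _ _
      _ = (S'.col P.n).frobLogvol m (Setting.labelSucc i) vQ
            (P.thetaRegion (e m) (Setting.labelSucc i) vQ) := hh
      _ = (S'.col P.n).frobLogvol (e m) (Setting.labelSucc i) vQ
            (P.thetaRegion (e m) (Setting.labelSucc i) vQ) := hfc m (e m) _ _ _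
  · have hh := h i vQ
    calc (S'.col P.n).frobLogvol m (Setting.labelSucc i) vQ
          (P.qRegion (Setting.labelSucc i) vQ)
        = (S'.col P.n).frobLogvol (e m) (Setting.labelSucc i) vQ
            (P.qRegion (Setting.labelSucc i) vQ) := hfc m (e m) _ _ _
      _ = (S'.col P.n).frobLogvol (e m) (Setting.labelSucc i) vQ
            (P.thetaRegion (e m) (Setting.labelSucc i) vQ) := hh
      _ = (S'.col P.n).frobLogvol m (Setting.labelSucc i) vQ
            (P.thetaRegion (e m) (Setting.labelSucc i) vQ) := hfc (e m) m _ _ _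

/-- Under m-independent readings the pointwise `≤`-form ABSORBS the (Ind3) relabelling. [claim:
Mochizuki2012, status: disputed] -/
theorem reindexGlue_qFrobComparison_iff_of_frobConst
    (hfc : ∀ (m m' : ℤ) (j : T.Label) (vQ : T.VQ) (A : Set (S'.toSituation.L.Packet j vQ)),
      (S'.col P.n).frobLogvol m j vQ A = (S'.col P.n).frobLogvol m' j vQ A) :
    QFrobComparison (P.reindexGlue e) ↔ QFrobComparison P := by
  unfold QFrobComparison
  constructor <;> intro h i vQ
  · obtain ⟨m, hm⟩ := h i vQ
    exact ⟨e m, ((hfc (e m) m _ _ _).trans_le hm).trans_eq (hfc m (e m) _ _ _)⟩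
  · obtain ⟨m, hm⟩ := h i vQ
    refine ⟨e.symm m, ?_⟩
    show (S'.col P.n).frobLogvol (e.symm m) (Setting.labelSucc i) vQ
        (P.qRegion (Setting.labelSucc i) vQ) ≤
      (S'.col P.n).frobLogvol (e.symm m) (Setting.labelSucc i) vQ
        (P.thetaRegion (e (e.symm m)) (Setting.labelSucc i) vQ)
    rw [Equiv.apply_symm_apply]
    exact ((hfc (e.symm m) m _ _ _).trans_le hm).trans_eq (hfc m (e.symm m) _ _ _)

end ReindexGlue

/-! ## 3. The étale-picture column transport: one explicit cross-column reading clause -/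

section Recolumn

variable (P : Cor312.Setting S'.toSituation) (n' : ℤ) (Φ : S'.toSituation.L.PacketAut)
  (hD : S'.D n' = (S'.D P.n).map Φ)

/-- `QFrobEqualityAt` along the étale transport, modulo ONE explicit identification: the column-`n'`
readings of transported regions agree with the column-`P.n` readings (`hfrobMap`) — the cross-column
transport of the holomorphic readings, which NO frozen clause supplies (the C-13c finding at the B-INPUT
level); discharged on admissible regions by `recolumn_frobLogvol_map_of_kummerA` below. [claim:
Mochizuki2012, status: disputed] -/
theorem recolumn_qFrobEqualityAt_iff
    (hfrobMap : ∀ (m : ℤ) (j : T.Label) (vQ : T.VQ) (A : Set (S'.toSituation.L.Packet j vQ)),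
      (S'.col n').frobLogvol m j vQ (Φ j vQ '' A) = (S'.col P.n).frobLogvol m j vQ A)
    (m : ℤ) : QFrobEqualityAt (P.recolumn n' Φ hD) m ↔ QFrobEqualityAt P m :=
  qFrobEqualityAt_congr (P₁ := P.recolumn n' Φ hD) (P₂ := P)
    (fun mm i vQ => hfrobMap mm (Setting.labelSucc i) vQ _)
    (fun mm i vQ => hfrobMap mm (Setting.labelSucc i) vQ _) m

/-- `QFrobComparison` along the étale transport, same single clause. [claim: Mochizuki2012, status:
disputed] -/
theorem recolumn_qFrobComparison_iff
    (hfrobMap : ∀ (m : ℤ) (j : T.Label) (vQ : T.VQ) (A : Set (S'.toSituation.L.Packet j vQ)),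
      (S'.col n').frobLogvol m j vQ (Φ j vQ '' A) = (S'.col P.n).frobLogvol m j vQ A) :
    QFrobComparison (P.recolumn n' Φ hD) ↔ QFrobComparison P :=
  qFrobComparison_congr (P₁ := P.recolumn n' Φ hD) (P₂ := P)
    (fun mm i vQ => hfrobMap mm (Setting.labelSucc i) vQ _)
    (fun mm i vQ => hfrobMap mm (Setting.labelSucc i) vQ _)

include hD in
/-- **The cross-column reading clause is a THEOREM on admissible regions under typed (ii) (a) at BOTH
columns**: `Column.KummerA` pins each column's readings to its mono-analytic log-volumes, and
`MRData.map` carries those definitionally — i.e. what the étale transport of the residual B-INPUT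
consumes beyond the frozen types is exactly Thm. 3.11 (ii)-ACROSS-COLUMNS content. [folklore] -/
theorem recolumn_frobLogvol_map_of_kummerA
    (hka' : (S'.col n').KummerA (S'.D n')) (hka : (S'.col P.n).KummerA (S'.D P.n))
    (m : ℤ) (j : T.Label) (vQ : T.VQ) {A : Set (S'.toSituation.L.Packet j vQ)}
    (hA : (S'.D P.n).Adm j vQ A) :
    (S'.col n').frobLogvol m j vQ (Φ j vQ '' A) = (S'.col P.n).frobLogvol m j vQ A := by
  have hA' : (S'.D n').Adm j vQ (Φ j vQ '' A) := by
    rw [hD]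
    show (S'.D P.n).Adm j vQ (⇑((Φ j vQ).symm) '' (⇑(Φ j vQ) '' A))
    rw [Setting.image_symm_image]
    exact hA
  have hvol : (S'.D n').logvol j vQ (Φ j vQ '' A) = (S'.D P.n).logvol j vQ A := by
    rw [hD]
    show (S'.D P.n).logvol j vQ (⇑((Φ j vQ).symm) '' (⇑(Φ j vQ) '' A)) = _
    rw [Setting.image_symm_image]
  rw [(hka' m j vQ _ hA').2, (hka m j vQ A hA).2, hvol]

/-- Étale-coricity of the printed equality form, with the cross-column clause DISCHARGED by typed
(ii) (a) at both columns + `ThetaRegionsAdm` (q-side admissibility is the theorem `qRegion_adm`).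
[claim: Mochizuki2012, status: disputed] -/
theorem recolumn_qFrobEqualityAt_iff_of_kummerA
    (hka' : (S'.col n').KummerA (S'.D n')) (hka : (S'.col P.n).KummerA (S'.D P.n))
    (hadm : ThetaRegionsAdm P) (m : ℤ) :
    QFrobEqualityAt (P.recolumn n' Φ hD) m ↔ QFrobEqualityAt P m :=
  qFrobEqualityAt_congr (P₁ := P.recolumn n' Φ hD) (P₂ := P)
    (fun mm i vQ => recolumn_frobLogvol_map_of_kummerA P n' Φ hD hka' hka mm
      (Setting.labelSucc i) vQ (P.qRegion_adm (Setting.labelSucc i) vQ))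
    (fun mm i vQ => recolumn_frobLogvol_map_of_kummerA P n' Φ hD hka' hka mm
      (Setting.labelSucc i) vQ (hadm mm i vQ)) m

/-- Étale-coricity of the pointwise `≤`-form under the same discharge. [claim: Mochizuki2012, status:
disputed] -/
theorem recolumn_qFrobComparison_iff_of_kummerA
    (hka' : (S'.col n').KummerA (S'.D n')) (hka : (S'.col P.n).KummerA (S'.D P.n))
    (hadm : ThetaRegionsAdm P) :
    QFrobComparison (P.recolumn n' Φ hD) ↔ QFrobComparison P :=
  qFrobComparison_congr (P₁ := P.recolumn n' Φ hD) (P₂ := P)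
    (fun mm i vQ => recolumn_frobLogvol_map_of_kummerA P n' Φ hD hka' hka mm
      (Setting.labelSucc i) vQ (P.qRegion_adm (Setting.labelSucc i) vQ))
    (fun mm i vQ => recolumn_frobLogvol_map_of_kummerA P n' Φ hD hka' hka mm
      (Setting.labelSucc i) vQ (hadm mm i vQ))

end Recolumn

/-! ## 4. The q-glue twist: explicit q-side reading cost, discharged via KummerA + Step (x) -/

section QTwistGlue

variable (P : Cor312.Setting S'.toSituation) (Φ₀ : S'.toSituation.L.PacketAut)
  (hmem : ∀ (j : T.Label) (vQ : T.VQ),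
    Φ₀ j vQ '' P.qRegionOf (qPilotObject P.qData) j vQ ∈ (P.frame j vQ).Hul)
  (hfin : ∀ j : T.Label, (Function.support fun vQ =>
    (S'.D P.n).logvol j vQ (Φ₀ j vQ '' P.qRegionOf (qPilotObject P.qData) j vQ)).Finite)

/-- `QFrobEqualityAt` under the q-glue twist, modulo the explicit q-side reading cost. [claim:
Mochizuki2012, status: disputed] -/
theorem qTwistGlue_qFrobEqualityAt_iff
    (hfrobq : ∀ (m : ℤ) (i : Fin T.lstar) (vQ : T.VQ),
      (S'.col P.n).frobLogvol m (Setting.labelSucc i) vQ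
          (Φ₀ (Setting.labelSucc i) vQ '' P.qRegion (Setting.labelSucc i) vQ) =
        (S'.col P.n).frobLogvol m (Setting.labelSucc i) vQ (P.qRegion (Setting.labelSucc i) vQ))
    (m : ℤ) : QFrobEqualityAt (P.qTwistGlue Φ₀ hmem hfin) m ↔ QFrobEqualityAt P m :=
  qFrobEqualityAt_congr (P₁ := P.qTwistGlue Φ₀ hmem hfin) (P₂ := P)
    (fun mm i vQ => hfrobq mm i vQ) (fun _ _ _ => rfl) m

/-- `QFrobComparison` under the q-glue twist, same cost. [claim: Mochizuki2012, status: disputed] -/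
theorem qTwistGlue_qFrobComparison_iff
    (hfrobq : ∀ (m : ℤ) (i : Fin T.lstar) (vQ : T.VQ),
      (S'.col P.n).frobLogvol m (Setting.labelSucc i) vQ
          (Φ₀ (Setting.labelSucc i) vQ '' P.qRegion (Setting.labelSucc i) vQ) =
        (S'.col P.n).frobLogvol m (Setting.labelSucc i) vQ (P.qRegion (Setting.labelSucc i) vQ)) :
    QFrobComparison (P.qTwistGlue Φ₀ hmem hfin) ↔ QFrobComparison P :=
  qFrobComparison_congr (P₁ := P.qTwistGlue Φ₀ hmem hfin) (P₂ := P)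
    (fun mm i vQ => hfrobq mm i vQ) (fun _ _ _ => rfl)

/-- Q-glue canonicity of the residual B-INPUT under typed (ii) (a) + the Step (x) engine — the q-side
admissibility is the landed theorem `qRegion_adm`, so NO extra side condition remains. [claim:
Mochizuki2012, status: disputed] -/
theorem qTwistGlue_qFrobComparison_iff_of_invariance
    (hka : (S'.col P.n).KummerA (S'.D P.n))
    (hAdm : ∀ Φ ∈ S'.toSituation.L.Ind1Family ∪ S'.toSituation.L.Ind2Family,
      ∀ (j : T.Label) (vQ : T.VQ) (A : Set (S'.toSituation.L.Packet j vQ)),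
        (S'.D P.n).Adm j vQ A ↔ (S'.D P.n).Adm j vQ (Φ j vQ '' A))
    (hvol : (S'.D P.n).LogvolInvariant) (hΦ₀ : Φ₀ ∈ Setting.indGroup S'.toSituation) :
    QFrobComparison (P.qTwistGlue Φ₀ hmem hfin) ↔ QFrobComparison P :=
  qTwistGlue_qFrobComparison_iff P Φ₀ hmem hfin (fun mm i vQ =>
    frobLogvol_image_eq_of_kummerA_of_invariance P Φ₀ hka hAdm hvol hΦ₀ mm
      (Setting.labelSucc i) vQ (P.qRegion_adm (Setting.labelSucc i) vQ))

end QTwistGlue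

end Cor312Vol

end IUTFork

end Summit.ABC
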